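import Literature.NumberTheory.PAdicHodge.BdRPlusFormalLogModFil
import Literature.NumberTheory.PAdicHodge.AinfSpanPXiTheta
import Literature.NumberTheory.PAdicHodge.KummerFilZeroCoboundaryRationalPoints
import Literature.NumberTheory.EllipticCurves.FormalGroupLimitLogSeries
import HarnessLib

/-!
# `θ(log_W(ι[ũ]) mod Fil^k) = log_ω(P)`: the `θ`-value of Fontaine's integrating element IS the `p`-adic logarithm of the point

Topic `Literature/NumberTheory/PAdicHodge`; namespace `Literature.NumberTheory.PAdicHodge.GaloisContinuity`. THEOREMS ONLY (no definition, no
instance, no named fact, no `sorry`). The junction between the Fontaine side of the tree — `IsFormalLogModFil W k x L` («`L ∈ B_dR⁺` is a value of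
`log_W(ι x)` modulo `Fil^k`», `BdRPlusFormalLogModFil`; `IsFormalLogModFil.thetaBdR_eq_of_tendsto`: `θ(L)` is the sum of the classical series
`Σ coeff_n(log_W) θ(ι x)ⁿ` in `ℂ_F` whenever it converges) applied to Fontaine's integral `[ũ] ∈ Ŵ(𝔫)` of a `[p]`-division sequence `u` of a point
`P = u₀ ∈ Ŵ(p𝒪_{ℂ_F})` (K1 `AinfTop.torsionLift`, `θ([ũ]) = u₀`) — and the elliptic-curve side: `log_ω = FormalGroupChart.padicLogPointFiniteExt`
(`PadicLogFiniteExtension`), the logarithm of Kato's explicit reciprocity law `EllipticCurves.tatePairingPoint_eq_trace_expStar_log(_tower)`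
(`DualExpEllipticReciprocityLaw`). The analytic input is `EllipticCurves.FormalGroupLimitLogSeries` (`Σ coeff_n(log_E) z(Q)ⁿ = ℓ_p(Q) = log_ω(Q)` on
`E⁽ᵖ⁾(K)` over every complete ultrametric `K`, here `K = ℂ_F`).

* ★★ `IsFormalLogModFil.thetaBdR_eq_padicLogPointFiniteExt_ptOfZ` — for `‖u₀‖ ≤ ‖p‖` (⟺ `[ũ]` has its coordinate in `(p, ξ)`,
  `torsionLift_mem_span_p_xi_iff`), `k ≥ 1` and ANY value `L` of `log_W(ι[ũ])` modulo `Fil^k`: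
  **`θ(L) = log_ω(P(u₀))`**, `P(u₀) = ptOfZ ℂ_F W u₀ ∈ E₁(ℂ_F)` the point with parameter `u₀` (AEC VII.2.2), `log_ω` of `E = curveOver ℂ_F W`;
* ★★ `IsFormalLogModFil.thetaBdR_eq_padicLogPointFiniteExt_of_zCoord_eq` — the same for any `Q₀ ∈ E₁(ℂ_F)` with `z(Q₀) = u₀`;
* `algebraMap_limitLog_curveF`, ★ `algebraMap_padicLogPointFiniteExt_curveF` — **functoriality `F → ℂ_F` of `log_ω` on the level** in K1's
  currency (`E(F) → E(F̄) → E(ℂ_F)` = `geomToC ∘ toGeomPoints`, `curveF F W = W ⊗ F`, any compatible `w`): `log_ω^{ℂ_F}(ι P) = ι(log_ω^{F,w}(P))`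
  for `P ∈ E⁽ᵖ⁾(F)` (uniqueness of `|p|`-adic limits, `F → ℂ_F` isometric);
* ★★★ `IsFormalLogModFil.thetaBdR_eq_algebraMap_padicLogPointFiniteExt` — for an `F`-RATIONAL point `P ∈ E⁽ᵖ⁾(F)` of `E = W ⊗ F` and a
  division sequence `u` of its image (`u₀ = ι z(P)`): **`θ(L) = ι_F(log_ω P)`** with `log_ω = padicLogPointFiniteExt w (AinfTop.curveF F W) p` for ANY
  valuation `w` of `F` compatible with its valuative structure — the quantity `log_ω P ∈ F` of [REC]; `…_natCast_mul_…` for ANY `P ∈ E(F)`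
  through a multiple `m • P ∈ E⁽ᵖ⁾(F)`; `…_of_divSeq` — the same in K1's currency (`uₙ = z(Qₙ)` for a `p`-power division sequence `Q` of `P` in
  `E(F̄)` inside `E₁(ℂ_F)`, `AinfTop.mulPC_zPt_divSeq`), plugging directly next to `AinfTop.isFilZeroCoboundary_kummer_curveF_of_five_le`.

* §4 the `p^r`-TRICK (memo §5 (2)): `ptOfZ_mulPC(_iterate)` (`P([p]_W^r t) = p^r • P(t)`), `exists_norm_iterate_mulPC_le` (every point of `Ŵ(𝔪_{ℂ_F})` has a
  `[p]`-power multiple in `Ŵ(p𝒪_{ℂ_F})`), ★★ `IsFormalLogModFil.thetaBdR_eq_pow_mul_padicLogPointFiniteExt_ptOfZ` — for a division sequence `v` of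
  `[p]_W^r u₀ ∈ Ŵ(p𝒪)` and any value `L` of `log_W(ι[ṽ])` mod `Fil^k`: **`θ(L) = p^r · log_ω(P(u₀))`** (so `p^{-r}L` integrates with `θ`-value `log_ω(P(u₀))`
  for EVERY point of `Ŵ(𝔪_{ℂ_F})`).

Floor (H4) step (3) of `Summits/…/Cruxes/StarredOptimalManinUnitFiveSeven/Lines/kato-lever-K3-B2-road.md`, memo `…-K3-H4-log.md` §5 (1)–(2) (crux K★
`stmt-BirchSwinnertonDyer-22226`). Infrastructure only; BSD / K★ are not proved by any of this.

## References
* J.-M. Fontaine, *Formes différentielles et modules de Tate…*, Invent. Math. 65 (1982), §5. [Fontaine1982FormesDifferentielles]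
* S. Bloch, K. Kato, *L-functions and Tamagawa numbers of motives* (1990), Ex. 3.10.1, (3.11.1). [BlochKato1990]
* J. H. Silverman, *The Arithmetic of Elliptic Curves* (2009), Thm. IV.6.4 with Prop. VII.2.2. [SilvermanAEC2009]
-/

noncomputable section

namespace Literature.NumberTheory.PAdicHodge

namespace GaloisContinuity

open scoped NNReal Classical
open ValuativeRel Field Ideal WittVector Filter
open _root_.Topology
open Literature.NumberTheory.GaloisRepresentations Literature.NumberTheory.GaloisRepresentations.IsNonarchimedeanLocalField
open Literature.NumberTheory.GaloisRepresentations.LubinTate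
open Literature.NumberTheory.EllipticCurves Literature.NumberTheory.EllipticCurves.FormalGroupChart

variable {F : Type} [Field F] [ValuativeRel F] [TopologicalSpace F] [IsNonarchimedeanLocalField F]
  [CharZero F] {p : ℕ} [Fact p.Prime] [Fact (¬ IsUnit (p : integerC F))]
  [IsAdicComplete (Ideal.span {(p : integerC F)}) (integerC F)]
  {hθ : Function.Surjective (fontaineTheta (integerC F) p)}

/-! ## §1 `θ(ι[ũ]) = u₀` and the coefficients -/

/-- **`θ(ι[ũ]) = u₀` in `ℂ_F`**: the image in `B_dR⁺` of the coordinate of Fontaine's integral of a division sequence has `θ`-value the base point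
(K1 `thetaPt_divisionLiftPt`). [cite: Fontaine1982FormesDifferentielles, §5] -/
theorem thetaBdR_ainfToBdR_torsionLift (W : WeierstrassCurve ℤ) (u : ℕ → (maxNilIdealC F).toIdeal)
    (hup : ∀ n, AinfTop.mulPC F p W (u (n + 1)) = u n) :
    thetaBdR (ainfToBdR ((AinfTop.of F p).symm (AinfTop.torsionLift W hθ u hup))) =
      (((u 0 : (maxNilIdealC F).toIdeal) : CBall F) : CompletedAlgClosure F) := by
  rw [thetaBdR_ainfToBdR, ← AinfTop.coe_theta, RingEquiv.apply_symm_apply]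
  have h2 := AinfTop.thetaPt_divisionLiftPt W (hθ := hθ) u hup
  have h3 := congrArg (fun P : W.Pt (maxNilIdealC F) => ((P.val : CBall F) : CompletedAlgClosure F)) h2
  simpa only [AinfTop.coe_val_thetaPt, AinfTop.coe_val_divisionLiftPt] using h3

omit [Fact (¬ IsUnit (p : integerC F))] [IsAdicComplete (Ideal.span {(p : integerC F)}) (integerC F)] in
/-- The coefficients of `log_W` read through `ℚ → ℚ_p → F → ℂ_F` are those read through `ℚ → ℂ_F`. [cite: SilvermanAEC2009, IV.5.5] -/
theorem algebraMap_padicRingHom_coeff_formalLog [CharZero (CompletedAlgClosure F)] (hp : valuation F p < 1) (W : WeierstrassCurve ℤ) (n : ℕ) :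
    algebraMap F (CompletedAlgClosure F) (LocalField.padicRingHom F p hp (PowerSeries.coeff n (W.map (Int.castRingHom ℚ_[p])).formalLog)) =
      algebraMap ℚ (CompletedAlgClosure F) (PowerSeries.coeff n (W.map (Int.castRingHom ℚ)).formalLog) := by
  have hmap : (W.map (Int.castRingHom ℚ)).map (algebraMap ℚ ℚ_[p]) = W.map (Int.castRingHom ℚ_[p]) := by
    rw [WeierstrassCurve.map_map]; congr 1
  rw [← hmap, ← WeierstrassCurve.map_formalLog, PowerSeries.coeff_map]
  exact RingHom.congr_fun (Subsingleton.elim (((algebraMap F (CompletedAlgClosure F)).comp (LocalField.padicRingHom F p hp)).comp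
    (algebraMap ℚ ℚ_[p])) (algebraMap ℚ (CompletedAlgClosure F))) _

/-! ## §2 `θ(log_W(ι[ũ]) mod Fil^k) = log_ω(P(u₀))` over `ℂ_F` -/

/-- ★★ **`θ(log_W(ι[ũ]) mod Fil^k) = log_ω(P(u₀))`.** Let `u` be a `[p]`-division sequence of points of `Ŵ(𝔪_{ℂ_F})` with `‖u₀‖ ≤ ‖p‖`
(`P = u₀ ∈ Ŵ(p𝒪_{ℂ_F})`, i.e. `[ũ]` has its coordinate in `(p, ξ)`), `k ≥ 1`, and `L ∈ B_dR⁺` any value of `log_W(ι[ũ])` modulo `Fil^k`. Then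
`θ(L)` is the `p`-adic logarithm `log_ω = padicLogPointFiniteExt` (of `E = curveOver ℂ_F W`, AEC IV.6.4 / VII.2.2) of the point `P(u₀) ∈ E₁(ℂ_F)` with
parameter `u₀`: `θ(L) = lim Σ_{m<M} coeff_{m+1}(log_W) u₀^{m+1}` (`IsFormalLogModFil.thetaBdR_eq_of_tendsto`) and the series sums to `log_ω(P(u₀))`
(`EllipticCurves.tendsto_sum_algebraMap_coeff_formalLog_mul_pow_padicLogPointFiniteExt`). [cite: Fontaine1982FormesDifferentielles, §5]
[cite: BlochKato1990, Ex. 3.10.1] [cite: SilvermanAEC2009, Thm. IV.6.4 with Prop. VII.2.2] -/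
theorem IsFormalLogModFil.thetaBdR_eq_padicLogPointFiniteExt_ptOfZ (hp : valuation F p < 1) (W : WeierstrassCurve ℤ)
    [(curveOver (CompletedAlgClosure F) W).IsElliptic] {k : ℕ} (hk : 1 ≤ k)
    {u : ℕ → (maxNilIdealC F).toIdeal} (hup : ∀ n, AinfTop.mulPC F p W (u (n + 1)) = u n)
    (hu : ‖(((u 0 : (maxNilIdealC F).toIdeal) : CBall F) : CompletedAlgClosure F)‖ ≤ ‖(p : CompletedAlgClosure F)‖)
    {L : BDeRhamPlus (integerC F) p} (hL : IsFormalLogModFil W k ((AinfTop.of F p).symm (AinfTop.torsionLift W hθ u hup)) L) :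
    thetaBdR L = padicLogPointFiniteExt (NormedField.valuation (K := CompletedAlgClosure F)) (curveOver (CompletedAlgClosure F) W) p
      (ptOfZ (CompletedAlgClosure F) W (u 0)) := by
  haveI : CharZero (CompletedAlgClosure F) := charZero_of_injective_algebraMap (algebraMap F _).injective
  have hpC : ‖(p : CompletedAlgClosure F)‖ < 1 := norm_natCast_C_lt_one hp
  refine IsFormalLogModFil.thetaBdR_eq_of_tendsto hp hk hL ?_
  simp only [thetaBdR_ainfToBdR_torsionLift, algebraMap_padicRingHom_coeff_formalLog]
  exact tendsto_sum_algebraMap_coeff_formalLog_mul_pow_padicLogPointFiniteExt W hpC hu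

/-- ★★ **`θ(log_W(ι[ũ]) mod Fil^k) = log_ω(Q₀)` for any `Q₀ ∈ E₁(ℂ_F)` with `z(Q₀) = u₀`** (`Q₀ = P(z(Q₀))`, AEC VII.2.2 `eq_ptOfZ_zPt`).
[cite: Fontaine1982FormesDifferentielles, §5] [cite: SilvermanAEC2009, Thm. IV.6.4 with Prop. VII.2.2] -/
theorem IsFormalLogModFil.thetaBdR_eq_padicLogPointFiniteExt_of_zCoord_eq (hp : valuation F p < 1) (W : WeierstrassCurve ℤ)
    [(curveOver (CompletedAlgClosure F) W).IsElliptic] {k : ℕ} (hk : 1 ≤ k)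
    {u : ℕ → (maxNilIdealC F).toIdeal} (hup : ∀ n, AinfTop.mulPC F p W (u (n + 1)) = u n)
    {Q₀ : (curveOver (CompletedAlgClosure F) W).toAffine.Point}
    (hQ₀ : Q₀ ∈ kernel (NormedField.valuation (K := CompletedAlgClosure F)) (curveOver (CompletedAlgClosure F) W))
    (hzQ₀ : Q₀.zCoord = (((u 0 : (maxNilIdealC F).toIdeal) : CBall F) : CompletedAlgClosure F))
    (hz : ‖Q₀.zCoord‖ ≤ ‖(p : CompletedAlgClosure F)‖)
    {L : BDeRhamPlus (integerC F) p} (hL : IsFormalLogModFil W k ((AinfTop.of F p).symm (AinfTop.torsionLift W hθ u hup)) L) :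
    thetaBdR L = padicLogPointFiniteExt (NormedField.valuation (K := CompletedAlgClosure F)) (curveOver (CompletedAlgClosure F) W) p Q₀ := by
  have hzPt : zPt Q₀ hQ₀ = u 0 := Subtype.ext (Subtype.ext hzQ₀)
  rw [eq_ptOfZ_zPt hQ₀, hzPt]
  exact hL.thetaBdR_eq_padicLogPointFiniteExt_ptOfZ hp W hk hup (by rw [← hzQ₀]; exact hz)

/-! ## §3 Functoriality `F → ℂ_F` of `log_ω` on the level, in K1's currency, and the `F`-rational form -/

section Rational

variable (W : WeierstrassCurve ℤ)

omit [CharZero F] [Fact p.Prime] [Fact (¬ IsUnit (p : integerC F))] [IsAdicComplete (Ideal.span {(p : integerC F)}) (integerC F)] in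
/-- `w x ≤ w y` for a compatible valuation `w` of `F` iff `‖ι x‖ ≤ ‖ι y‖` in `ℂ_F` (`F → ℂ_F` is isometric for the valuation norm).
[cite: SilvermanAEC2009, Prop. VII.2.2] -/
theorem norm_algebraMap_le_iff_val_le (w : Valuation F ℝ≥0) [w.Compatible] (x y : F) :
    ‖algebraMap F (CompletedAlgClosure F) x‖ ≤ ‖algebraMap F (CompletedAlgClosure F) y‖ ↔ w x ≤ w y := by
  rw [CompletedAlgClosure.norm_algebraMap, CompletedAlgClosure.norm_algebraMap, norm_le_norm_iff_vle,
    Valuation.Compatible.vle_iff_le (v := w)]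

omit [CharZero F] [Fact p.Prime] [Fact (¬ IsUnit (p : integerC F))] [IsAdicComplete (Ideal.span {(p : integerC F)}) (integerC F)] in
/-- **`E(F) → E(ℂ_F)` maps the level `E⁽ᵖ⁾(F)` into the level `E⁽ᵖ⁾(ℂ_F)`** (it preserves `E₁` and the parameter).
[cite: SilvermanAEC2009, Prop. VII.2.2] -/
theorem geomToC_toGeomPoints_mem_level (w : Valuation F ℝ≥0) [w.Compatible] [(AinfTop.curveF F W).IsIntegral w.integer]
    {P : (AinfTop.curveF F W).toAffine.Point} (hP : P ∈ level w (AinfTop.curveF F W) (w (p : F))) :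
    AinfTop.geomToC W (WeierstrassCurve.toGeomPoints (AinfTop.curveF F W) P) ∈
      level (NormedField.valuation (K := CompletedAlgClosure F)) (curveOver (CompletedAlgClosure F) W)
        (NormedField.valuation (p : CompletedAlgClosure F)) := by
  refine ⟨AinfTop.geomToC_toGeomPoints_mem_kernel W w hP.1, ?_⟩
  rw [← NNReal.coe_le_coe, NormedField.valuation_apply, NormedField.valuation_apply, coe_nnnorm, coe_nnnorm,
    AinfTop.zCoord_geomToC_toGeomPoints, ← map_natCast (algebraMap F (CompletedAlgClosure F)) p, norm_algebraMap_le_iff_val_le w]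
  exact hP.2

omit [Fact (¬ IsUnit (p : integerC F))] [IsAdicComplete (Ideal.span {(p : integerC F)}) (integerC F)] in
/-- **Functoriality `F → ℂ_F` of the limit logarithm on the level**, in K1's currency: for `P ∈ E⁽ᵖ⁾(F)` of `E = W ⊗ F` and any compatible
valuation `w` of `F`, `ℓ_p^{ℂ_F}(ι P) = ι(ℓ_p^{F, w}(P))`, `ι P = geomToC (toGeomPoints P) ∈ E(ℂ_F)` (both sides satisfy the defining approximation
property (SPEC) at `ι P`; `F → ℂ_F` is isometric; uniqueness of `|p|`-adic limits `limitLog_eq_of_forall_val_sub_approx_le`).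
[cite: SilvermanAEC2009, Thm. IV.6.4 with Prop. VII.2.2] -/
theorem algebraMap_limitLog_curveF (hp : valuation F p < 1) [(curveOver (CompletedAlgClosure F) W).IsElliptic]
    (w : Valuation F ℝ≥0) [w.Compatible] [(AinfTop.curveF F W).IsIntegral w.integer] {P : (AinfTop.curveF F W).toAffine.Point}
    (hP : P ∈ level w (AinfTop.curveF F W) (w (p : F))) :
    algebraMap F (CompletedAlgClosure F) (limitLog w (AinfTop.curveF F W) p P) =
      limitLog (NormedField.valuation (K := CompletedAlgClosure F)) (curveOver (CompletedAlgClosure F) W) p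
        (AinfTop.geomToC W (WeierstrassCurve.toGeomPoints (AinfTop.curveF F W) P)) := by
  haveI : CharZero (CompletedAlgClosure F) := charZero_of_injective_algebraMap (algebraMap F _).injective
  have hp0 : (p : F) ≠ 0 := Nat.cast_ne_zero.2 (Fact.out : p.Prime).ne_zero
  have hp0C : (p : CompletedAlgClosure F) ≠ 0 := Nat.cast_ne_zero.2 (Fact.out : p.Prime).ne_zero
  have hpC : NormedField.valuation (p : CompletedAlgClosure F) < 1 := by
    rw [← NNReal.coe_lt_coe, NormedField.valuation_apply, coe_nnnorm]; exact norm_natCast_C_lt_one hp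
  have hspecF := limitLog_spec_of_isNonarchimedeanLocalField (AinfTop.curveF F W) w hp0 hp
  set ι := algebraMap F (CompletedAlgClosure F) with hι
  symm
  refine limitLog_eq_of_forall_val_sub_approx_le hpC (limitLog_spec_of_completeSpace hp0C hpC) (geomToC_toGeomPoints_mem_level W w hP)
    fun r => ?_
  -- `z(pʳ ιP) = ι z(pʳ P)`, so the difference is `ι` of the `F`-difference
  have hz : ((p ^ r) • AinfTop.geomToC W (WeierstrassCurve.toGeomPoints (AinfTop.curveF F W) P)).zCoord = ι ((p ^ r) • P).zCoord := by
    rw [← map_nsmul, ← map_nsmul, AinfTop.zCoord_geomToC_toGeomPoints]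
  have hdiff : ι (limitLog w (AinfTop.curveF F W) p P) - ((p ^ r) • AinfTop.geomToC W (WeierstrassCurve.toGeomPoints (AinfTop.curveF F W) P)).zCoord /
      (p : CompletedAlgClosure F) ^ r = ι (limitLog w (AinfTop.curveF F W) p P - ((p ^ r) • P).zCoord / (p : F) ^ r) := by
    rw [hz, map_sub, map_div₀, map_pow, map_natCast]
  rw [hdiff, ← NNReal.coe_le_coe, NormedField.valuation_apply, NNReal.coe_pow, NormedField.valuation_apply, coe_nnnorm, coe_nnnorm,
    ← map_natCast ι p, ← norm_pow, ← map_pow, norm_algebraMap_le_iff_val_le w, map_pow]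
  exact hspecF P hP r

omit [Fact (¬ IsUnit (p : integerC F))] [IsAdicComplete (Ideal.span {(p : integerC F)}) (integerC F)] in
/-- ★ **Functoriality `F → ℂ_F` of `log_ω` on the level: `log_ω^{ℂ_F}(ι P) = ι(log_ω^{F,w}(P))` for `P ∈ E⁽ᵖ⁾(F)`** (`log_ω = ℓ_p` on the levels).
[cite: SilvermanAEC2009, Thm. IV.6.4 with Prop. VII.2.2] -/
theorem algebraMap_padicLogPointFiniteExt_curveF (hp : valuation F p < 1) [(curveOver (CompletedAlgClosure F) W).IsElliptic]
    (w : Valuation F ℝ≥0) [w.Compatible] [(AinfTop.curveF F W).IsIntegral w.integer] {P : (AinfTop.curveF F W).toAffine.Point}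
    (hP : P ∈ level w (AinfTop.curveF F W) (w (p : F))) :
    algebraMap F (CompletedAlgClosure F) (padicLogPointFiniteExt w (AinfTop.curveF F W) p P) =
      padicLogPointFiniteExt (NormedField.valuation (K := CompletedAlgClosure F)) (curveOver (CompletedAlgClosure F) W) p
        (AinfTop.geomToC W (WeierstrassCurve.toGeomPoints (AinfTop.curveF F W) P)) := by
  haveI : CharZero (CompletedAlgClosure F) := charZero_of_injective_algebraMap (algebraMap F _).injective
  have hp0 : (p : F) ≠ 0 := Nat.cast_ne_zero.2 (Fact.out : p.Prime).ne_zero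
  have hp0C : (p : CompletedAlgClosure F) ≠ 0 := Nat.cast_ne_zero.2 (Fact.out : p.Prime).ne_zero
  have hpw : w (p : F) < 1 := (ValuativeRel.isEquiv w (valuation F)).lt_one_iff_lt_one.mpr hp
  have hpC : NormedField.valuation (p : CompletedAlgClosure F) < 1 := by
    rw [← NNReal.coe_lt_coe, NormedField.valuation_apply, coe_nnnorm]; exact norm_natCast_C_lt_one hp
  rw [padicLogPointFiniteExt_eq_limitLog hp0 hpw (limitLog_spec_of_isNonarchimedeanLocalField (AinfTop.curveF F W) w hp0 hp) hP,
    padicLogPointFiniteExt_eq_limitLog hp0C hpC (limitLog_spec_of_completeSpace hp0C hpC) (geomToC_toGeomPoints_mem_level W w hP),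
    algebraMap_limitLog_curveF W hp w hP]

/-- ★★★ **`θ(log_W(ι[ũ]) mod Fil^k) = ι_F(log_ω P)` for an `F`-rational point.** Let `E = W ⊗ F` (`curveF F W`), `w` a valuation of `F` compatible
with its valuative structure, `P ∈ E⁽ᵖ⁾(F)` (`P ∈ E₁(F)`, `|z(P)|_w ≤ |p|_w`), `u` a `[p]`-division sequence in `Ŵ(𝔪_{ℂ_F})` of the image of `P`
(`u₀ = ι z(P)`), `k ≥ 1`, and `L ∈ B_dR⁺` a value of `log_W(ι[ũ])` modulo `Fil^k`. Then **`θ(L) = algebraMap F ℂ_F (log_ω P)`**,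
`log_ω = padicLogPointFiniteExt w (AinfTop.curveF F W) p` — the logarithm of Kato's explicit reciprocity law. [cite: Fontaine1982FormesDifferentielles, §5]
[cite: BlochKato1990, Ex. 3.10.1, (3.11.1)] [cite: SilvermanAEC2009, Thm. IV.6.4 with Prop. VII.2.2] -/
theorem IsFormalLogModFil.thetaBdR_eq_algebraMap_padicLogPointFiniteExt (hp : valuation F p < 1)
    [(curveOver (CompletedAlgClosure F) W).IsElliptic] {k : ℕ} (hk : 1 ≤ k) (w : Valuation F ℝ≥0) [w.Compatible]
    [(AinfTop.curveF F W).IsIntegral w.integer] {P : (AinfTop.curveF F W).toAffine.Point} (hP : P ∈ level w (AinfTop.curveF F W) (w (p : F)))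
    {u : ℕ → (maxNilIdealC F).toIdeal} (hup : ∀ n, AinfTop.mulPC F p W (u (n + 1)) = u n)
    (hu₀ : (((u 0 : (maxNilIdealC F).toIdeal) : CBall F) : CompletedAlgClosure F) = algebraMap F (CompletedAlgClosure F) P.zCoord)
    {L : BDeRhamPlus (integerC F) p} (hL : IsFormalLogModFil W k ((AinfTop.of F p).symm (AinfTop.torsionLift W hθ u hup)) L) :
    thetaBdR L = algebraMap F (CompletedAlgClosure F) (padicLogPointFiniteExt w (AinfTop.curveF F W) p P) := by
  have hlev := geomToC_toGeomPoints_mem_level W (p := p) w hP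
  have hzQ : (AinfTop.geomToC W (WeierstrassCurve.toGeomPoints (AinfTop.curveF F W) P)).zCoord =
      (((u 0 : (maxNilIdealC F).toIdeal) : CBall F) : CompletedAlgClosure F) := by
    rw [AinfTop.zCoord_geomToC_toGeomPoints, hu₀]
  have hz : ‖(AinfTop.geomToC W (WeierstrassCurve.toGeomPoints (AinfTop.curveF F W) P)).zCoord‖ ≤ ‖(p : CompletedAlgClosure F)‖ := by
    have h := hlev.2
    rwa [← NNReal.coe_le_coe, NormedField.valuation_apply, NormedField.valuation_apply, coe_nnnorm, coe_nnnorm] at h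
  rw [algebraMap_padicLogPointFiniteExt_curveF W hp w hP]
  exact hL.thetaBdR_eq_padicLogPointFiniteExt_of_zCoord_eq hp W hk hup hlev.1 hzQ hz

/-- ★★ **Arbitrary `F`-rational points: `θ(L) = m · ι_F(log_ω P)`** when `u` is a division sequence of the image of `m • P ∈ E⁽ᵖ⁾(F)` (such an
`m ≥ 1` always exists over a non-archimedean local field: `exists_nsmul_mem_level_of_isNonarchimedeanLocalField`; `log_ω(m • P) = m · log_ω(P)`).
[cite: Fontaine1982FormesDifferentielles, §5] [cite: SilvermanAEC2009, Thm. IV.6.4 with Prop. VII.2.2] -/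
theorem IsFormalLogModFil.thetaBdR_eq_natCast_mul_algebraMap_padicLogPointFiniteExt (hp : valuation F p < 1)
    [(curveOver (CompletedAlgClosure F) W).IsElliptic] [(AinfTop.curveF F W).IsElliptic] {k : ℕ} (hk : 1 ≤ k)
    (w : Valuation F ℝ≥0) [w.Compatible] [(AinfTop.curveF F W).IsIntegral w.integer] {P : (AinfTop.curveF F W).toAffine.Point} {m : ℕ}
    (hmP : m • P ∈ level w (AinfTop.curveF F W) (w (p : F)))
    {u : ℕ → (maxNilIdealC F).toIdeal} (hup : ∀ n, AinfTop.mulPC F p W (u (n + 1)) = u n)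
    (hu₀ : (((u 0 : (maxNilIdealC F).toIdeal) : CBall F) : CompletedAlgClosure F) = algebraMap F (CompletedAlgClosure F) (m • P).zCoord)
    {L : BDeRhamPlus (integerC F) p} (hL : IsFormalLogModFil W k ((AinfTop.of F p).symm (AinfTop.torsionLift W hθ u hup)) L) :
    thetaBdR L = (m : CompletedAlgClosure F) * algebraMap F (CompletedAlgClosure F) (padicLogPointFiniteExt w (AinfTop.curveF F W) p P) := by
  have hp0 : (p : F) ≠ 0 := Nat.cast_ne_zero.2 (Fact.out : p.Prime).ne_zero
  rw [hL.thetaBdR_eq_algebraMap_padicLogPointFiniteExt W hp hk w hmP hup hu₀,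
    padicLogPointFiniteExt_nsmul_of_isNonarchimedeanLocalField (AinfTop.curveF F W) w hp0 hp P m, map_mul, map_natCast]

/-- ★★★ **Division-sequence form, in the currency of K1 (`AinfTop.isFilZeroCoboundary_kummer_curveF_of_five_le`).** Let `P ∈ E⁽ᵖ⁾(F)`,
`Q` a `p`-power division sequence of `P` in `E(F̄)` (`p • Q_{n+1} = Q_n`, `Q₀ = P`) all of whose members lie in `E₁(ℂ_F)` (`hker`; automatic at good
supersingular reduction, `AinfTop.geomToC_divSeq_mem_kernel`), and `uₙ := z(Qₙ) ∈ 𝔪_{ℂ_F}` the associated `[p]_W`-division sequence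
(`AinfTop.mulPC_zPt_divSeq`). Then for every value `L` of `log_W(ι[ũ])` modulo `Fil^k`, `k ≥ 1`: **`θ(L) = ι_F(log_ω P)`**.
[cite: Fontaine1982FormesDifferentielles, §5] [cite: BlochKato1990, Ex. 3.10.1, (3.11.1)] [cite: SilvermanAEC2009, Thm. IV.6.4 with Prop. VII.2.2] -/
theorem IsFormalLogModFil.thetaBdR_eq_algebraMap_padicLogPointFiniteExt_of_divSeq (hp : valuation F p < 1)
    [(curveOver (CompletedAlgClosure F) W).IsElliptic] {k : ℕ} (hk : 1 ≤ k) (w : Valuation F ℝ≥0) [w.Compatible]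
    [(AinfTop.curveF F W).IsIntegral w.integer] {P : (AinfTop.curveF F W).toAffine.Point} (hP : P ∈ level w (AinfTop.curveF F W) (w (p : F)))
    {Q : ℕ → (AinfTop.curveF F W).geomPoints} (hQ : ∀ n, p • Q (n + 1) = Q n) (hQ0 : Q 0 = WeierstrassCurve.toGeomPoints (AinfTop.curveF F W) P)
    (hker : ∀ n, AinfTop.geomToC W (Q n) ∈ kernel (NormedField.valuation (K := CompletedAlgClosure F)) (curveOver (CompletedAlgClosure F) W))
    {L : BDeRhamPlus (integerC F) p}
    (hL : IsFormalLogModFil W k ((AinfTop.of F p).symm (AinfTop.torsionLift W hθ (fun n => zPt (AinfTop.geomToC W (Q n)) (hker n))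
      (AinfTop.mulPC_zPt_divSeq W (F := F) hQ hker))) L) :
    thetaBdR L = algebraMap F (CompletedAlgClosure F) (padicLogPointFiniteExt w (AinfTop.curveF F W) p P) := by
  have hz0 : (((zPt (AinfTop.geomToC W (Q 0)) (hker 0) : (ballNilIdeal (CompletedAlgClosure F)).toIdeal) :
      unitBall (CompletedAlgClosure F)) : CompletedAlgClosure F) = algebraMap F (CompletedAlgClosure F) P.zCoord := by
    rw [coe_zPt, hQ0, AinfTop.zCoord_geomToC_toGeomPoints]
  exact hL.thetaBdR_eq_algebraMap_padicLogPointFiniteExt W hp hk w hP (u := fun n => zPt (AinfTop.geomToC W (Q n)) (hker n))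
    (AinfTop.mulPC_zPt_divSeq W (F := F) hQ hker) hz0

end Rational

/-! ## §4 The `p^r`-trick: points of `Ŵ(𝔪_{ℂ_F})` not in `Ŵ(p𝒪_{ℂ_F})` -/

section PowTrick

variable (W : WeierstrassCurve ℤ) [(curveOver (CompletedAlgClosure F) W).IsElliptic]

omit [CharZero F] [Fact p.Prime] [Fact (¬ IsUnit (p : integerC F))] [IsAdicComplete (Ideal.span {(p : integerC F)}) (integerC F)] in
/-- **`P([p]_W t) = p • P(t)` in `E(ℂ_F)`**: the formal multiplication `AinfTop.mulPC` on `Ŵ(𝔪_{ℂ_F})` is multiplication by `p` on `E₁(ℂ_F)`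
(AEC VII.2.2, tree `zPt_nsmul`). [cite: SilvermanAEC2009, Prop. VII.2.2] -/
theorem ptOfZ_mulPC (t : (maxNilIdealC F).toIdeal) :
    ptOfZ (CompletedAlgClosure F) W (AinfTop.mulPC F p W t) = p • ptOfZ (CompletedAlgClosure F) W t := by
  have h := zPt_nsmul p (ptOfZ_mem_kernel (K := CompletedAlgClosure F) (W := W) t)
  rw [zPt_ptOfZ] at h
  rw [eq_ptOfZ_zPt ((kernel (NormedField.valuation (K := CompletedAlgClosure F)) (curveOver (CompletedAlgClosure F) W)).nsmul_mem
    (ptOfZ_mem_kernel t) p), h]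
  rfl

omit [CharZero F] [Fact p.Prime] [Fact (¬ IsUnit (p : integerC F))] [IsAdicComplete (Ideal.span {(p : integerC F)}) (integerC F)] in
/-- **`P([p]_W^{r} t) = p^r • P(t)`.** [cite: SilvermanAEC2009, Prop. VII.2.2] -/
theorem ptOfZ_mulPC_iterate (t : (maxNilIdealC F).toIdeal) (r : ℕ) :
    ptOfZ (CompletedAlgClosure F) W ((AinfTop.mulPC F p W)^[r] t) = p ^ r • ptOfZ (CompletedAlgClosure F) W t := by
  induction r with
  | zero => rw [Function.iterate_zero, id, pow_zero, one_smul]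
  | succ r ih => rw [Function.iterate_succ_apply', ptOfZ_mulPC, ih, smul_smul, pow_succ']

omit [Fact (¬ IsUnit (p : integerC F))] [IsAdicComplete (Ideal.span {(p : integerC F)}) (integerC F)] in
/-- **Every point of `Ŵ(𝔪_{ℂ_F})` has a `[p]`-power multiple in `Ŵ(p𝒪_{ℂ_F})`**: `‖[p]_W^{r} t‖ ≤ ‖p‖` for some `r` (the chart estimate
`|z(p•Q)| ≤ max(|p||z(Q)|, |z(Q)|²)` iterated, tree `exists_pow_smul_mem_level_of_mem_kernel`). [cite: SilvermanAEC2009, Prop. IV.3.2 with Prop. VII.2.2] -/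
theorem exists_norm_iterate_mulPC_le (t : (maxNilIdealC F).toIdeal) :
    ∃ r : ℕ, ‖((((AinfTop.mulPC F p W)^[r] t : (maxNilIdealC F).toIdeal) : CBall F) : CompletedAlgClosure F)‖ ≤ ‖(p : CompletedAlgClosure F)‖ := by
  haveI : CharZero (CompletedAlgClosure F) := charZero_of_injective_algebraMap (algebraMap F _).injective
  have hp0C : (p : CompletedAlgClosure F) ≠ 0 := Nat.cast_ne_zero.2 (Fact.out : p.Prime).ne_zero
  obtain ⟨r, hr⟩ := exists_pow_smul_mem_level_of_mem_kernel hp0C (ptOfZ_mem_kernel (K := CompletedAlgClosure F) (W := W) t)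
  refine ⟨r, ?_⟩
  rw [← ptOfZ_mulPC_iterate] at hr
  have h := hr.2
  rwa [zCoord_ptOfZ, ← NNReal.coe_le_coe, NormedField.valuation_apply, NormedField.valuation_apply, coe_nnnorm, coe_nnnorm] at h

/-- ★★ **The `p^r`-trick** (memo `…-K3-H4-log.md` §5 (2)): let `u₀ ∈ Ŵ(𝔪_{ℂ_F})` be ANY point (no smallness), `r` with `‖[p]_W^{r} u₀‖ ≤ ‖p‖`
(`exists_norm_iterate_mulPC_le`), `v` a `[p]`-division sequence of `v₀ = [p]_W^{r} u₀` (e.g. `vₙ = [p]_W^{r} uₙ` for a division sequence `u` of `u₀`) and `L`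
any value of `log_W(ι[ṽ])` modulo `Fil^k`, `k ≥ 1`. Then **`θ(L) = p^r · log_ω(P(u₀))`** — so `p^{-r} L ∈ B_dR⁺` is an integrating element with
`θ`-value `log_ω(P(u₀))` for every point of `Ŵ(𝔪_{ℂ_F})` (`log_ω(p^r • P) = p^r log_ω(P)`, `padicLogPointFiniteExt_nsmul`).
[cite: Fontaine1982FormesDifferentielles, §5] [cite: SilvermanAEC2009, Thm. IV.6.4 with Prop. VII.2.2] -/
theorem IsFormalLogModFil.thetaBdR_eq_pow_mul_padicLogPointFiniteExt_ptOfZ (hp : valuation F p < 1) {k : ℕ} (hk : 1 ≤ k) (r : ℕ)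
    (u₀ : (maxNilIdealC F).toIdeal) {v : ℕ → (maxNilIdealC F).toIdeal} (hvp : ∀ n, AinfTop.mulPC F p W (v (n + 1)) = v n)
    (hv₀ : v 0 = (AinfTop.mulPC F p W)^[r] u₀)
    (hv : ‖(((v 0 : (maxNilIdealC F).toIdeal) : CBall F) : CompletedAlgClosure F)‖ ≤ ‖(p : CompletedAlgClosure F)‖)
    {L : BDeRhamPlus (integerC F) p} (hL : IsFormalLogModFil W k ((AinfTop.of F p).symm (AinfTop.torsionLift W hθ v hvp)) L) :
    thetaBdR L = (p : CompletedAlgClosure F) ^ r *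
      padicLogPointFiniteExt (NormedField.valuation (K := CompletedAlgClosure F)) (curveOver (CompletedAlgClosure F) W) p
        (ptOfZ (CompletedAlgClosure F) W u₀) := by
  haveI : CharZero (CompletedAlgClosure F) := charZero_of_injective_algebraMap (algebraMap F _).injective
  have hp0C : (p : CompletedAlgClosure F) ≠ 0 := Nat.cast_ne_zero.2 (Fact.out : p.Prime).ne_zero
  have hpC : NormedField.valuation (p : CompletedAlgClosure F) < 1 := by
    rw [← NNReal.coe_lt_coe, NormedField.valuation_apply, coe_nnnorm]; exact norm_natCast_C_lt_one hp
  have hlev : p ^ r • ptOfZ (CompletedAlgClosure F) W u₀ ∈ level (NormedField.valuation (K := CompletedAlgClosure F))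
      (curveOver (CompletedAlgClosure F) W) (NormedField.valuation (p : CompletedAlgClosure F)) := by
    rw [← ptOfZ_mulPC_iterate, ← hv₀]; exact ptOfZ_mem_level W hv
  rw [hL.thetaBdR_eq_padicLogPointFiniteExt_ptOfZ hp W hk hvp hv, hv₀, ptOfZ_mulPC_iterate,
    padicLogPointFiniteExt_nsmul hp0C hpC (limitLog_spec_of_completeSpace hp0C hpC) (pow_pos (Fact.out : p.Prime).pos r) hlev (p ^ r),
    Nat.cast_pow]

end PowTrick

end GaloisContinuity

end Literature.NumberTheory.PAdicHodge

end
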